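import Literature.Claims.NS.Fathi2025

/-!
# Solo refutation — C150 `Fathi2025` (K. Fathi, «Global Regularity of the 3D Incompressible Navier–Stokes
# Equations via Energy Estimates, Bootstrap Closure, and Vorticity Control», Zenodo 15384518 v5, 7 pp.)

D-0090 «where NS proofs break» map, cell `ns-claims`; refuter of record ns-claims-refuter-5 g3 (blind prediction
sealed cf10c12c7fc39ae4 before the pin pages / TYPED). Skeleton of record: `Literature.Claims.NS.Fathi2025`
(typist-12 g5, p525980, sha16 0e29843ef01889c5). Text of record = census pin `census/texts/Fathi2025/`
(PDF sha16 ccfa546aeee3c05c; page = file pNNN; line numbers = text layer).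

**Token = first failing step in PRINT ORDER (cell keying rule, as C146)** = `Step41_used`, Lemma 4.1 AS USED,
§4.1 p.4 l.43–59 («Therefore, the vorticity remains uniformly bounded», l.59), typed at the ODE grain the lemma is
stated in: every nonnegative `y` on `[0,T)` with right derivative `≤ C₁y + C₂y³ + F₀²` is bounded on `[0,T)`.
**Class: FALSE LEMMA (countermodel)** — `not_Step41_used` below: the explicit profile `y(t) = (1 − t)^{−1/2}` on
`[0,1)` at `(C₁,C₂,F₀,T) = (0,1,0,1)` has `y' = ½y³ ≤ y³` and exceeds every `M` before `t = 1` (the comparison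
equation `z' = C₂z³` leaves every bound in finite time). The §4.1 branch is composed in the skeleton as
`claim_of_steps_vort : Step32_ineq → Step41_used → Step41_inference → VortBoundedAll`.

**Alongside = first failing step on the COMPOSITION PATH `claim_of_steps : Step23_local → Step42_cubic →
Step42_close → Step42_inference → ClaimedTheorem`** = `Step42_close`, §4.2 p.5 l.44 «Choosing K large enough to
dominate the right-hand side ensures the estimate closes», typed at the real-arithmetic grain of the display
l.34–43; FALSE LEMMA (countermodel) by `not_Step42_close` (explicit `K = max K₀ 4` at `(E₀,C_s,T,F) = (0,1,1,0)`:
`K√K ≥ 2K > K` — the larger `K`, the worse); `no_closing_K` records that the existential reading «some K closes»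
fails as well (at `(1,1,1,0)` no real `K` serves), so no quantifier charity on `K` rescues the sentence — only a
short-time / small-data hypothesis does (every charitable face is the local theory presented as global; cf. §4.3
p.5 l.46–49 «constants … not on T»). `Step23_local`, `Step32_ineq`, `Step42_cubic` (TRUE-type, classical) and
`Step5_BKM` (discharged in the skeleton) are not attacked; `Step41_inference` / `Step42_inference` are
implications with false antecedents (vacuously true), not kill faces.

Standard axioms only. WHAT THIS IS NOT: not a claim about NS regularity or blow-up; not a claim about any author
beyond the typed locator. [cite: Fathi2025]
-/

set_option linter.dupNamespace false

open Set

namespace Summit.NavierStokesRegularity.NavierStokesRegularity.Theorems.Fathi2025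

open Literature.Claims.NS.Fathi2025

noncomputable section

/-! ## 1. The token (print order): `Step41_used` — Lemma 4.1 as used (p.4 l.43–59) is false -/

/-- **`¬ Step41_used`** — Lemma 4.1 AS USED («every nonnegative `y` on `[0,T)` with right derivative
`≤ C₁y + C₂y³ + F₀²` is bounded on `[0,T)`») is false at `(C₁, C₂, F₀, T) = (0, 1, 0, 1)`: the explicit profile
`y(t) = (1 − t)^{−1/2}` has `y' = ½y³ ≤ y³` on `[0,1)` and `y(1 − (|M|+2)^{−2}) = |M| + 2 > M` for every `M`
(the comparison equation `z' = C₂z³` leaves every bound in finite time — exactly the typist's flag). First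
failing step in print order; the §4.1 branch is composed as `claim_of_steps_vort`. [cite: Fathi2025, Lemma 4.1 p.4 l.43–59] -/
theorem not_Step41_used : ¬ Step41_used := by
  intro h
  set y : ℝ → ℝ := fun s => (Real.sqrt (1 - s))⁻¹ with hy
  set D : ℝ → ℝ := fun s => 1 / 2 * ((Real.sqrt (1 - s))⁻¹) ^ 3 with hD
  have hnonneg : ∀ t ∈ Ico (0 : ℝ) 1, 0 ≤ y t := fun t _ => by
    simp only [hy]; positivity
  have hderiv : ∀ t ∈ Ico (0 : ℝ) 1,
      HasDerivWithinAt y (D t) (Ici t) t ∧ D t ≤ 0 * y t + 1 * y t ^ 3 + 0 ^ 2 := by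
    intro t ht
    have hpos : 0 < 1 - t := by linarith [ht.2]
    have hr : 0 < Real.sqrt (1 - t) := Real.sqrt_pos.2 hpos
    have h1 : HasDerivAt (fun s : ℝ => 1 - s) (-1) t := by
      simpa using (hasDerivAt_id t).const_sub 1
    have h2 : HasDerivAt (fun s : ℝ => Real.sqrt (1 - s)) (-1 / (2 * Real.sqrt (1 - t))) t :=
      h1.sqrt hpos.ne'
    have h3 := h2.inv hr.ne'
    have hrne : Real.sqrt (1 - t) ≠ 0 := hr.ne'
    refine ⟨(h3.congr_deriv ?_).hasDerivWithinAt, ?_⟩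
    · simp only [hD]
      field_simp
    · simp only [hD, hy]
      have h0 : 0 ≤ ((Real.sqrt (1 - t))⁻¹) ^ 3 := by positivity
      nlinarith [h0]
  obtain ⟨M, hM⟩ := h 0 1 0 le_rfl one_pos le_rfl 1 one_pos y D hnonneg hderiv
  -- the profile exceeds `M` before `t = 1`
  set a : ℝ := 1 / (|M| + 2) with ha
  have ha0 : 0 < a := by rw [ha]; positivity
  have ha1 : a ≤ 1 / 2 := by
    rw [ha]; apply div_le_div_of_nonneg_left zero_le_one (by norm_num); linarith [abs_nonneg M]
  have ht₀ : 1 - a ^ 2 ∈ Ico (0 : ℝ) 1 := by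
    constructor <;> nlinarith [ha0, ha1]
  have hval : y (1 - a ^ 2) = |M| + 2 := by
    simp only [hy]
    rw [show (1 : ℝ) - (1 - a ^ 2) = a ^ 2 by ring, Real.sqrt_sq ha0.le, ha, one_div, inv_inv]
  have := hM (1 - a ^ 2) ht₀
  rw [hval] at this
  linarith [le_abs_self M]


/-! ## 2. Alongside (composition path `claim_of_steps`): `Step42_close` (p.5 l.44) is false -/

/-- **`¬ Step42_close`** — «Choosing K large enough to dominate the right-hand side ensures the estimate
closes» (p.5 l.44, typed at the real-arithmetic grain of the display l.34–43: all sufficiently large `K` satisfy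
`E₀ + C_s·K√K·T + F ≤ K`) is false: at `(E₀, C_s, T, F) = (0, 1, 1, 0)` and any threshold `K₀`, the value
`K = max K₀ 4` has `√K ≥ 2`, so `K√K ≥ 2K > K`. The larger `K`, the worse — `K^{3/2}` outgrows `K`.
[cite: Fathi2025, §4.2 p.5 l.34–45] -/
theorem not_Step42_close : ¬ Step42_close := by
  intro h
  obtain ⟨K₀, hK⟩ := h 0 1 1 0 le_rfl one_pos one_pos le_rfl
  have hK4 : (4 : ℝ) ≤ max K₀ 4 := le_max_right _ _
  have h2 : (2 : ℝ) ≤ Real.sqrt (max K₀ 4) := by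
    have h4 : Real.sqrt 4 = (2 : ℝ) := by
      rw [show (4 : ℝ) = 2 ^ 2 by norm_num, Real.sqrt_sq (by norm_num)]
    rw [← h4]
    exact Real.sqrt_le_sqrt hK4
  have hle := hK (max K₀ 4) (le_max_left _ _)
  nlinarith [hK4, h2, hle]

/-- **The existential reading fails too** (records-grade, ahead of any charitable re-typing «SOME K closes the
bootstrap»): at `(E₀, C_s, T, F) = (1, 1, 1, 0)` NO real `K` satisfies `E₀ + C_s·K√K·T + F ≤ K` — for `K < 0`
the left side is `1`, for `0 ≤ K < 1` it is `≥ 1 > K`, for `K ≥ 1` it is `≥ 1 + K`. (A closing `K` exists only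
in the short-time/small-data regime `E₀ + F ≤ 4/(27·C_s²T²)`.) [cite: Fathi2025, §4.2 p.5 l.34–45] -/
theorem no_closing_K : ¬ ∃ K : ℝ, 1 + 1 * (K * Real.sqrt K) * 1 + 0 ≤ K := by
  rintro ⟨K, hK⟩
  rcases lt_or_ge K 1 with h | h
  · rcases le_or_gt 0 K with h0 | h0
    · have h1 : 0 ≤ K * Real.sqrt K := mul_nonneg h0 (Real.sqrt_nonneg _)
      linarith
    · have : Real.sqrt K = 0 := Real.sqrt_eq_zero'.2 h0.le
      rw [this] at hK; linarith
  · have h1 : 1 ≤ Real.sqrt K := by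
      rw [show (1 : ℝ) = Real.sqrt 1 from Real.sqrt_one.symm]
      exact Real.sqrt_le_sqrt h
    nlinarith

-- Standard axioms only: [propext, Classical.choice, Quot.sound].
#print axioms not_Step41_used
#print axioms not_Step42_close
#print axioms no_closing_K

end

end Summit.NavierStokesRegularity.NavierStokesRegularity.Theorems.Fathi2025
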